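import Literature.MathematicalPhysics.QuantumFieldTheory.Balaban1983to89.B16RLeafRecord13LiveGenericZS
import Literature.MathematicalPhysics.QuantumFieldTheory.Balaban1983to89.Node00.Record13SepCoPHChi
import Literature.MathematicalPhysics.QuantumFieldTheory.Balaban1983to89.Node00.Record13ResidualsRChi
import Literature.MathematicalPhysics.QuantumFieldTheory.Balaban1983to89.B16RLeafRecord13LiveChi
import Literature.MathematicalPhysics.QuantumFieldTheory.Balaban1983to89.B16RLeafRecord13LiveRstepChi

/-!
# χ-GENERIC RE-ISSUE (WORK ORDER RC-1 «RE-CENTRE THE RECORD», director-ym №462 (B) ∕ №467 (D)) of `B16RLeafRecord13LiveGenericZS`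

Cell `pub-ymgap` (HUMAN RULING D-0062, Track A), seat `pub-ymgap-dag-n11-d` (N11 [B14] s2; N11-σ campaign, `N11-G44-RC1-REACH-CENSUS.md`).  The CENTRE-TYPED
declarations of `B16RLeafRecord13LiveGenericZS` (those whose statement reads the (2.9) cut-off centre through `gOfRecord₁₃ ∕ EOfRecord₁₃ ∕ Provisos₁₃… ∕ T∕SLaw₁₃… ∕
UbgOfRecord₁₃… ∕ WtOfRecord₁₃… ∕ datum∕tower∕coreOfRecord₁₃…`) RE-ISSUED VERBATIM in the β-slot `χ : ChiSlot F N` over [Ax-3b]∕[Ax-3c]∕[Ax-3d]'s χ-generic carriers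
(`Node00/Record13Chi` ∕ `Record13CoPHChi` ∕ `Record13SepCoPHChi`): σ = (binder `(χ : ChiSlot F N)` after `θ`; Node00 defs `X ↦ XChi … χ`; Node00 rows `Y ↦ Y_chi`;
this lane's sibling modules `…Chi` for Summits-side dependencies); SAME short names in the sibling namespace `…B16RLeafRecord13LiveGenericZSChi` (consumers switch by namespace);
the 21 centre-FREE declarations of the original are NOT copied — they are reused BY NAME (`open … (…)` below).  At `χ := chiβOfRecord₁₃ θ` every statement here is
DEFINITIONALLY the landed one ([Ax-3b]'s `rfl` receipts); at `χ := chiβOfRecord₁₃Ax θ` it is what the Ax-record's N11 machine reads.  Nothing of record edited (body-freeze №460 (2)).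

HONEST FRAMING.  Count-neutral kernel re-elaboration of landed N11 bookkeeping∕estimates in a parameter; every HYPOTHESIS of the original stays a hypothesis; nothing of
Bałaban asserted beyond what the original file proves; N11 NOT discharged; K-items untouched; counts unmoved.  One finite `𝕋⁴_{L^K}` programme at fixed `ε = L^{−K}` —
NOT ℝ⁴, NOT OS, NOT a mass gap, NOT Clay.  No `sorry`∕`instance`∕`notation`.  Sources: as the original module, plus [I] = [Balaban1987RG1] (2.9) p.266 (the cut-off's centre).
-/

noncomputable section

open MeasureTheory
open scoped BigOperators Matrix.Norms.L2Operator

namespace Literature.MathematicalPhysics.QuantumFieldTheory.Balaban1983to89.B16RLeafRecord13LiveGenericZSChi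

open Literature.MathematicalPhysics.QuantumFieldTheory.Balaban1983to89.B16RLeafRecord13LiveGenericZS (slotTClauseΦ_succ_of_slotClauseΦ_of_dead_of_rstep slotTClauseΦ_succ_of_slotClauseΦ_of_liveSel_of_rstep slotClauseΦ_succ_of_slotTClauseΦ_of_liveSel_of_hasResiduals slotTClauseΦ_succ_of_slotClauseΦ_of_liveSel_of_hasResiduals slotClauseΦ_succ_of_slotTClauseΦ_liveRepin₁₃_of_hasResiduals slotClauseΦ_succ_of_slotTClauseΦ_theta13LiveOfRecord slotTClauseΦ_succ_of_slotClauseΦ_theta13LiveOfRecord hasSect2FormAEZS_succ_of_liveTAEZS_of_idem_of_dead_of_rstep slotsT_succ_aeForm_of_AEZS_succ_of_dead_of_rstep aeClause_of_Omega_empty_of_AEZS_succ_of_dead_of_rstep hasSect2FormAEZS_succ_of_liveSeqTAEZS_of_liveSel_of_rstep slotsT_succ_aeForm_of_AEZS_succ_of_liveSel_of_rstep hasSect2FormAEZS_succ_of_TAEZS_of_liveSel_of_hasResiduals slotsT_succ_aeForm_of_AEZS_succ_of_liveSel_of_hasResiduals aeClause_of_Omega_empty_of_AEZS_succ_of_liveSel_of_hasResiduals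 hasSect2FormAEZS_succ_of_TAEZS_liveRepin₁₃_of_hasResiduals slotsT_succ_aeForm_of_AEZS_succ_liveRepin₁₃_of_hasResiduals hasSect2FormAEZS_succ_of_TAEZS_theta13LiveOfNumerics slotsT_succ_aeForm_of_AEZS_succ_theta13LiveOfNumerics hasSect2FormAEZS_succ_of_TAEZS_theta13LiveOfRecord slotsT_succ_aeForm_of_AEZS_succ_theta13LiveOfRecord)
open T4Continuum T4DatumAssembly Node00 B14.Eq218Concrete DagBinding
open B16RLeafRecord11 B16RLeafRecord12 B16RLeafRecord12Live B16RLeafRecord12AtLive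
open B16RLeafRecord13AtLive B16RLeafRecord13LiveGenericW B16RLeafRecord13LiveClauseW
open B16RLeafRecord13Live hiding dead_of_ppSel_succ_ne_of_liveSel gOfRecord₁₃_succ_nonneg ppSel_succ_idem_of_liveSel slotsOfRecord₁₃_succ_eq_zero_of_dead slotsOfRecord₁₃_succ_eq_zero_of_not_mem_range slotsOfRecord₁₃_succ_eq_zero_of_slotsT_eq_zero
open B16RLeafRecord13LiveChi
open B16RLeafRecord13LiveRstep hiding slotsOfRecord₁₃_succ_ae_eq_slotsT_of_fix_of_dead_of_rstep
open B16RLeafRecord13LiveRstepChi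

variable (F : T4Family) (N : ℕ) [NeZero N]

/-! ## §0  CLAUSE LEVEL — ONE sequence `s′`, ARBITRARY right-hand side `Φ : 𝐔 ↦ ℝ` (any edition of `sect2Slot … (Rz s′) (W s′) s′ t E U_{s′}` is an instance by `rfl`),
## from row `rstep`, idempotency and «moved ⇒ dead»; at `hsel`; at K0a's re-pin; AT THE WITNESS OF RECORD -/

section ClauseRstepOnly

variable (θ : Stage13Params F N) (χ : ChiSlot F N) (p : B12.RunParams)

/-- **★ THE FORWARD CLAUSE AT ONE SEQUENCE, ARBITRARY right-hand side `Φ`**: if the pre-𝐑 slot `slotT_{k+1}(s′)` has — provided `s′` is LIVE — the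
𝐓-image dichotomy «absent, or `= 𝐓_{k+1}(s′) exp A_{k+1}(s′)` a.e. on `supp χ_{k+1}(s′)`» for ANY right-hand side `Φ` (print's `𝐓_{k+1}(s′)[W s′] exp A_{k+1}(s′)[Rz s′]` at term values `t`, constant `E`, background `U_{s′}` — node00-def-T's
`sect2Slot … (Rz s′) (W s′) s′ t E U_{s′}` in ANY weight ∕ residual edition: v1.5 `CoP`, v1.6 `CoPR`, v1.7 `CoPH` with its HISTORY-INDEXED `θ.rzAtChi χ p s′`, `WtOfRecord₁₃H θ p s′`), then
the post-𝐑 slot `slot_{k+1}(s′)` has the SAME dichotomy with the SAME `Φ` — dead-moving branch, from row `rstep` alone: a dead `s′` is absent from `ρ_{k+1}`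
(`slotsOfRecord₁₃_succ_eq_zero_of_dead`), a live `s′` is a fixed point of the selector onto which only dead sequences move, where `slot = slotT` a.e. on the support
(`slotsOfRecord₁₃_succ_ae_eq_slotsT_of_fix_of_dead_of_rstep`).  `…LiveClauseW.slotClause_succ_of_slotTClause_of_idem_of_dead_of_rstep` (p529096) is the instance `Φ := sect2Slot … (θ.Rz p.K) W s′ t E U_{s′}` (by `rfl`); the proof is its, verbatim.
[cite: Balaban1988Convergent, §2 p.262, Thm 2 p.263, (3.24)–(3.25) p.270; Balaban1989LargeFieldI, (0.3) p.176, p.177 (i)–(ii)] -/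
theorem slotClauseΦ_succ_of_slotTClauseΦ_of_idem_of_dead_of_rstep
    (hrstep : ∀ (p : B12.RunParams) (k : ℕ) [DecidableEq (PBond (F.P p.K) (k + 1))], k < p.K →
      (towerRepOfRecord F N θ.ν θ.τ9 (slotsTOfRecord F N θ.ν θ.τ9 (EOfRecord₁₃Chi F N θ χ) (wOfRecord₉ F N θ.toStage9Params) θ.ppSel)
        θ.ppSel p (gOfRecord₁₃Chi F N θ χ p) (k + 1)).toRepData.ProvisosInt)
    (k : ℕ) (hk : k < p.K)
    (hidem : ∀ a, θ.ppSel p (gOfRecord₁₃Chi F N θ χ p) (k + 1) (θ.ppSel p (gOfRecord₁₃Chi F N θ χ p) (k + 1) a) = θ.ppSel p (gOfRecord₁₃Chi F N θ χ p) (k + 1) a)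
    (hdead : ∀ a, θ.ppSel p (gOfRecord₁₃Chi F N θ χ p) (k + 1) a ≠ a →
      ∀ V, B15.BasicStep.fibreIntegral (fibOfSeq F θ.ν θ.τ9 p (gOfRecord₁₃Chi F N θ χ p) (k + 1) a)
        (rterm (sliceOfRecord F N θ.ν θ.τ9.M p (gOfRecord₁₃Chi F N θ χ p) (k + 1)
          (slotsTOfRecord F N θ.ν θ.τ9 (EOfRecord₁₃Chi F N θ χ) (wOfRecord₉ F N θ.toStage9Params) θ.ppSel p (gOfRecord₁₃Chi F N θ χ p) (k + 1))) a) V = 0)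
    (s : SeqOfRecord F θ.ν θ.τ9.M (gOfRecord₁₃Chi F N θ χ p) p.K (k + 1)) (Φ : GaugeField (F.P p.K) (k + 1) (SU N) → ℝ)
    (hT : LiveSeq F N θ.ν θ.τ9 p (gOfRecord₁₃Chi F N θ χ p) (k + 1)
        (slotsTOfRecord F N θ.ν θ.τ9 (EOfRecord₁₃Chi F N θ χ) (wOfRecord₉ F N θ.toStage9Params) θ.ppSel p (gOfRecord₁₃Chi F N θ χ p) (k + 1)) s →
      (slotsTOfRecord F N θ.ν θ.τ9 (EOfRecord₁₃Chi F N θ χ) (wOfRecord₉ F N θ.toStage9Params) θ.ppSel p (gOfRecord₁₃Chi F N θ χ p) (k + 1) s = 0 ∨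
        ∀ᵐ V ∂(fieldMeasure (F.P p.K) (k + 1) (SU N)), chiSeqOfRecord F N θ.ν θ.τ9.M (gOfRecord₁₃Chi F N θ χ p) p.K (k + 1) s V ≠ 0 →
          slotsTOfRecord F N θ.ν θ.τ9 (EOfRecord₁₃Chi F N θ χ) (wOfRecord₉ F N θ.toStage9Params) θ.ppSel p (gOfRecord₁₃Chi F N θ χ p) (k + 1) s V
            = Φ V)) :
    slotsOfRecord F N θ.ν θ.τ9 (EOfRecord₁₃Chi F N θ χ) (wOfRecord₉ F N θ.toStage9Params) θ.ppSel p (gOfRecord₁₃Chi F N θ χ p) (k + 1) s = 0 ∨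
      ∀ᵐ V ∂(fieldMeasure (F.P p.K) (k + 1) (SU N)), chiSeqOfRecord F N θ.ν θ.τ9.M (gOfRecord₁₃Chi F N θ χ p) p.K (k + 1) s V ≠ 0 →
        slotsOfRecord F N θ.ν θ.τ9 (EOfRecord₁₃Chi F N θ χ) (wOfRecord₉ F N θ.toStage9Params) θ.ppSel p (gOfRecord₁₃Chi F N θ χ p) (k + 1) s V
          = Φ V := by
  by_cases hsd : ∀ V, B15.BasicStep.fibreIntegral (fibOfSeq F θ.ν θ.τ9 p (gOfRecord₁₃Chi F N θ χ p) (k + 1) s)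
        (rterm (sliceOfRecord F N θ.ν θ.τ9.M p (gOfRecord₁₃Chi F N θ χ p) (k + 1)
          (slotsTOfRecord F N θ.ν θ.τ9 (EOfRecord₁₃Chi F N θ χ) (wOfRecord₉ F N θ.toStage9Params) θ.ppSel p (gOfRecord₁₃Chi F N θ χ p) (k + 1))) s) V = 0
  · exact Or.inl (slotsOfRecord₁₃_succ_eq_zero_of_dead F N θ χ p k hidem hdead s hsd)
  · have hlive : LiveSeq F N θ.ν θ.τ9 p (gOfRecord₁₃Chi F N θ χ p) (k + 1)
        (slotsTOfRecord F N θ.ν θ.τ9 (EOfRecord₁₃Chi F N θ χ) (wOfRecord₉ F N θ.toStage9Params) θ.ppSel p (gOfRecord₁₃Chi F N θ χ p) (k + 1)) s := by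
      obtain ⟨V, hV⟩ : ∃ V, B15.BasicStep.fibreIntegral (fibOfSeq F θ.ν θ.τ9 p (gOfRecord₁₃Chi F N θ χ p) (k + 1) s)
          (rterm (sliceOfRecord F N θ.ν θ.τ9.M p (gOfRecord₁₃Chi F N θ χ p) (k + 1)
            (slotsTOfRecord F N θ.ν θ.τ9 (EOfRecord₁₃Chi F N θ χ) (wOfRecord₉ F N θ.toStage9Params) θ.ppSel p (gOfRecord₁₃Chi F N θ χ p) (k + 1))) s) V ≠ 0 := by
        by_contra hnone
        exact hsd fun V => by_contra fun hV => hnone ⟨V, hV⟩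
      obtain ⟨V₀, hf, hI⟩ := exists_live_of_fibreIntegral_rterm_ne_zero
        (sliceOfRecord F N θ.ν θ.τ9.M p (gOfRecord₁₃Chi F N θ χ p) (k + 1)
          (slotsTOfRecord F N θ.ν θ.τ9 (EOfRecord₁₃Chi F N θ χ) (wOfRecord₉ F N θ.toStage9Params) θ.ppSel p (gOfRecord₁₃Chi F N θ χ p) (k + 1)))
        (fibOfSeq F θ.ν θ.τ9 p (gOfRecord₁₃Chi F N θ χ p) (k + 1)) s V hV
      exact liveSeq_of_ne_zero F N _ hf hI
    have hfix : θ.ppSel p (gOfRecord₁₃Chi F N θ χ p) (k + 1) s = s := by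
      by_contra hne
      exact hsd (hdead s hne)
    rcases hT hlive with h0 | hid
    · exact Or.inl (slotsOfRecord₁₃_succ_eq_zero_of_slotsT_eq_zero F N θ χ p k s h0)
    · refine Or.inr ?_
      filter_upwards [hid, slotsOfRecord₁₃_succ_ae_eq_slotsT_of_fix_of_dead_of_rstep F N θ χ p hrstep k hk s hfix
        (fun a ha hne => hdead a fun heq => hne (heq.symm.trans ha))] with V hV hVid hχ
      rw [hVid hχ]
      exact hV hχ

end ClauseRstepOnly

section ClauseLiveSel

variable (θ : Stage13Params F N) (χ : ChiSlot F N) (p : B12.RunParams)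

/-- **★ Forward clause at one sequence at the live selector, from row `rstep`** (idempotency and «moved ⇒ dead» are theorems of the live selector of record).
[cite: Balaban1988Convergent, §2 p.262, (3.24)–(3.25) p.270; Balaban1989LargeFieldI, (0.3) p.176, p.177 (i)–(ii)] -/
theorem slotClauseΦ_succ_of_slotTClauseΦ_of_liveSel_of_rstep
    (hrstep : ∀ (p : B12.RunParams) (k : ℕ) [DecidableEq (PBond (F.P p.K) (k + 1))], k < p.K →
      (towerRepOfRecord F N θ.ν θ.τ9 (slotsTOfRecord F N θ.ν θ.τ9 (EOfRecord₁₃Chi F N θ χ) (wOfRecord₉ F N θ.toStage9Params) θ.ppSel)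
        θ.ppSel p (gOfRecord₁₃Chi F N θ χ p) (k + 1)).toRepData.ProvisosInt)
    (hsel : θ.ppSel = ppSelLiveOfRecord F N θ.ν θ.τ9 (EOfRecord₁₃Chi F N θ χ) (wOfRecord₉ F N θ.toStage9Params)) (k : ℕ) (hk : k < p.K)
    (s : SeqOfRecord F θ.ν θ.τ9.M (gOfRecord₁₃Chi F N θ χ p) p.K (k + 1)) (Φ : GaugeField (F.P p.K) (k + 1) (SU N) → ℝ)
    (hT : LiveSeq F N θ.ν θ.τ9 p (gOfRecord₁₃Chi F N θ χ p) (k + 1)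
        (slotsTOfRecord F N θ.ν θ.τ9 (EOfRecord₁₃Chi F N θ χ) (wOfRecord₉ F N θ.toStage9Params) θ.ppSel p (gOfRecord₁₃Chi F N θ χ p) (k + 1)) s →
      (slotsTOfRecord F N θ.ν θ.τ9 (EOfRecord₁₃Chi F N θ χ) (wOfRecord₉ F N θ.toStage9Params) θ.ppSel p (gOfRecord₁₃Chi F N θ χ p) (k + 1) s = 0 ∨
        ∀ᵐ V ∂(fieldMeasure (F.P p.K) (k + 1) (SU N)), chiSeqOfRecord F N θ.ν θ.τ9.M (gOfRecord₁₃Chi F N θ χ p) p.K (k + 1) s V ≠ 0 →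
          slotsTOfRecord F N θ.ν θ.τ9 (EOfRecord₁₃Chi F N θ χ) (wOfRecord₉ F N θ.toStage9Params) θ.ppSel p (gOfRecord₁₃Chi F N θ χ p) (k + 1) s V
            = Φ V)) :
    slotsOfRecord F N θ.ν θ.τ9 (EOfRecord₁₃Chi F N θ χ) (wOfRecord₉ F N θ.toStage9Params) θ.ppSel p (gOfRecord₁₃Chi F N θ χ p) (k + 1) s = 0 ∨
      ∀ᵐ V ∂(fieldMeasure (F.P p.K) (k + 1) (SU N)), chiSeqOfRecord F N θ.ν θ.τ9.M (gOfRecord₁₃Chi F N θ χ p) p.K (k + 1) s V ≠ 0 →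
        slotsOfRecord F N θ.ν θ.τ9 (EOfRecord₁₃Chi F N θ χ) (wOfRecord₉ F N θ.toStage9Params) θ.ppSel p (gOfRecord₁₃Chi F N θ χ p) (k + 1) s V
          = Φ V :=
  slotClauseΦ_succ_of_slotTClauseΦ_of_idem_of_dead_of_rstep F N θ χ p hrstep k hk (ppSel_succ_idem_of_liveSel F N θ χ hsel p k)
    (fun a hne V => dead_of_ppSel_succ_ne_of_liveSel F N θ χ hsel p k a hne V) s Φ hT

end ClauseLiveSel

/-! ## §1  LAW LEVEL — generic `θ`, HISTORY-INDEXED residual ∕ 𝐓-weight ∕ background families `Rz s`, `W s`, `U s`, from row `rstep`, idempotency and «moved ⇒ dead» -/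

section RstepOnly

variable (θ : Stage13Params F N) (χ : ChiSlot F N) (p : B12.RunParams)

/-- **★ THE FORWARD STEP OVER HISTORY-INDEXED RESIDUAL ∕ WEIGHT ∕ BACKGROUND FAMILIES**: if the pre-𝐑 family `slotT_{k+1}` has the 𝐓-image form at level `k` with background maps `U` (absent
slots allowed), then the post-𝐑 family `slot_{k+1}` has the §2 form at index `k+1` WITH THE SAME `U` — dead-moving branch, from row `rstep` alone (+ admissibility
and the three term-constant signs for the law monotonicity `HasSect2FormTAEZ.toFormAEZ_succ`).  (G6′) `…LiveGenericW.hasSect2FormAEZ_succ_of_TAEZ_of_idem_of_dead_of_rstep` is the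
CONSTANT-FAMILY instance `(Rz, W) := (fun _ => θ.Rz p.K, fun _ => W)` (`Iff.rfl`, node00-def-T `hasSect2FormTAEZS_const_iff` ∕ `hasSect2FormAEZS_const_iff`). [cite: Balaban1988Convergent, §2 p.262, Thm 2 p.263, (3.24)–(3.25) p.270; Balaban1989LargeFieldI, (0.3) p.176, p.177 (i)–(ii)] -/
theorem hasSect2FormAEZS_succ_of_TAEZS_of_idem_of_dead_of_rstep
    (hrstep : ∀ (p : B12.RunParams) (k : ℕ) [DecidableEq (PBond (F.P p.K) (k + 1))], k < p.K →
      (towerRepOfRecord F N θ.ν θ.τ9 (slotsTOfRecord F N θ.ν θ.τ9 (EOfRecord₁₃Chi F N θ χ) (wOfRecord₉ F N θ.toStage9Params) θ.ppSel)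
        θ.ppSel p (gOfRecord₁₃Chi F N θ χ p) (k + 1)).toRepData.ProvisosInt)
    (hθ : θ.Admissible F N) (hκ : 0 ≤ θ.s2.lf.κ) (hE₀ : 0 ≤ θ.s2.lf.E₀) (hB₀ : 0 ≤ θ.s2.lf.B₀) (k : ℕ) (hk : k < p.K)
    (hidem : ∀ a, θ.ppSel p (gOfRecord₁₃Chi F N θ χ p) (k + 1) (θ.ppSel p (gOfRecord₁₃Chi F N θ χ p) (k + 1) a) = θ.ppSel p (gOfRecord₁₃Chi F N θ χ p) (k + 1) a)
    (hdead : ∀ a, θ.ppSel p (gOfRecord₁₃Chi F N θ χ p) (k + 1) a ≠ a →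
      ∀ V, B15.BasicStep.fibreIntegral (fibOfSeq F θ.ν θ.τ9 p (gOfRecord₁₃Chi F N θ χ p) (k + 1) a)
        (rterm (sliceOfRecord F N θ.ν θ.τ9.M p (gOfRecord₁₃Chi F N θ χ p) (k + 1)
          (slotsTOfRecord F N θ.ν θ.τ9 (EOfRecord₁₃Chi F N θ χ) (wOfRecord₉ F N θ.toStage9Params) θ.ppSel p (gOfRecord₁₃Chi F N θ χ p) (k + 1))) a) V = 0)
    (Rz : SeqOfRecord F θ.ν θ.τ9.M (gOfRecord₁₃Chi F N θ χ p) p.K (k + 1) → Sect2.Residual (F.P p.K) (MatA N))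
    (W : SeqOfRecord F θ.ν θ.τ9.M (gOfRecord₁₃Chi F N θ χ p) p.K (k + 1) → TkWeights F N (FluctV N) p.K) (U : SeqOfRecord F θ.ν θ.τ9.M (gOfRecord₁₃Chi F N θ χ p) p.K (k + 1) → BgMap F N p.K)
    (hT : HasSect2FormTAEZS F N (FluctV N) p.K (settingOfRecord₁₃Chi F N θ χ p) k Rz W U
      (slotsTOfRecord F N θ.ν θ.τ9 (EOfRecord₁₃Chi F N θ χ) (wOfRecord₉ F N θ.toStage9Params) θ.ppSel p (gOfRecord₁₃Chi F N θ χ p) (k + 1))) :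
    HasSect2FormAEZS F N (FluctV N) p.K (settingOfRecord₁₃Chi F N θ χ p) (k + 1) Rz W U
      (slotsOfRecord F N θ.ν θ.τ9 (EOfRecord₁₃Chi F N θ χ) (wOfRecord₉ F N θ.toStage9Params) θ.ppSel p (gOfRecord₁₃Chi F N θ χ p) (k + 1)) := by
  obtain ⟨t, Ek, hu, hs⟩ := hT.toFormAEZS_succ hθ.toStage12.pos.2.1 hκ hE₀ hB₀ (gOfRecord₁₃_succ_nonneg F N θ χ p k)
  refine ⟨t, Ek, hu, fun s => ⟨(hs s).1, ?_⟩⟩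
  by_cases hmem : s ∈ Set.range (θ.ppSel p (gOfRecord₁₃Chi F N θ χ p) (k + 1))
  · obtain ⟨b, hb⟩ := hmem
    have hfix : θ.ppSel p (gOfRecord₁₃Chi F N θ χ p) (k + 1) s = s := by rw [← hb]; exact hidem b
    rcases (hs s).2 with h0 | hid
    · exact Or.inl (slotsOfRecord₁₃_succ_eq_zero_of_slotsT_eq_zero F N θ χ p k s h0)
    · refine Or.inr ?_
      filter_upwards [hid, slotsOfRecord₁₃_succ_ae_eq_slotsT_of_fix_of_dead_of_rstep F N θ χ p hrstep k hk s hfix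
        (fun a ha hne => hdead a fun heq => hne (heq.symm.trans ha))] with V hV hVid hχ
      rw [hVid hχ]
      exact hV hχ
  · exact Or.inl (slotsOfRecord₁₃_succ_eq_zero_of_not_mem_range F N θ χ p k s hmem)

end RstepOnly

/-! ## §2  At node00-def-T's selector clause `hsel`: from row `rstep`, and from K0b's `HasResidualsOfRecord` alone — history-indexed `Rz s`, `W s`, `U s` -/

section LiveSel

variable (θ : Stage13Params F N) (χ : ChiSlot F N) (p : B12.RunParams)

/-- **★ Forward step at the live selector, history-indexed `Rz s`, `W s`, `U s`, from row `rstep`.** [cite: Balaban1988Convergent, §2 p.262, (3.24)–(3.25) p.270; Balaban1989LargeFieldI, (0.3) p.176, p.177 (i)–(ii)] -/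
theorem hasSect2FormAEZS_succ_of_TAEZS_of_liveSel_of_rstep
    (hrstep : ∀ (p : B12.RunParams) (k : ℕ) [DecidableEq (PBond (F.P p.K) (k + 1))], k < p.K →
      (towerRepOfRecord F N θ.ν θ.τ9 (slotsTOfRecord F N θ.ν θ.τ9 (EOfRecord₁₃Chi F N θ χ) (wOfRecord₉ F N θ.toStage9Params) θ.ppSel)
        θ.ppSel p (gOfRecord₁₃Chi F N θ χ p) (k + 1)).toRepData.ProvisosInt)
    (hθ : θ.Admissible F N) (hκ : 0 ≤ θ.s2.lf.κ) (hE₀ : 0 ≤ θ.s2.lf.E₀) (hB₀ : 0 ≤ θ.s2.lf.B₀)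
    (hsel : θ.ppSel = ppSelLiveOfRecord F N θ.ν θ.τ9 (EOfRecord₁₃Chi F N θ χ) (wOfRecord₉ F N θ.toStage9Params)) (k : ℕ) (hk : k < p.K)
    (Rz : SeqOfRecord F θ.ν θ.τ9.M (gOfRecord₁₃Chi F N θ χ p) p.K (k + 1) → Sect2.Residual (F.P p.K) (MatA N))
    (W : SeqOfRecord F θ.ν θ.τ9.M (gOfRecord₁₃Chi F N θ χ p) p.K (k + 1) → TkWeights F N (FluctV N) p.K) (U : SeqOfRecord F θ.ν θ.τ9.M (gOfRecord₁₃Chi F N θ χ p) p.K (k + 1) → BgMap F N p.K)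
    (hT : HasSect2FormTAEZS F N (FluctV N) p.K (settingOfRecord₁₃Chi F N θ χ p) k Rz W U
      (slotsTOfRecord F N θ.ν θ.τ9 (EOfRecord₁₃Chi F N θ χ) (wOfRecord₉ F N θ.toStage9Params) θ.ppSel p (gOfRecord₁₃Chi F N θ χ p) (k + 1))) :
    HasSect2FormAEZS F N (FluctV N) p.K (settingOfRecord₁₃Chi F N θ χ p) (k + 1) Rz W U
      (slotsOfRecord F N θ.ν θ.τ9 (EOfRecord₁₃Chi F N θ χ) (wOfRecord₉ F N θ.toStage9Params) θ.ppSel p (gOfRecord₁₃Chi F N θ χ p) (k + 1)) :=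
  hasSect2FormAEZS_succ_of_TAEZS_of_idem_of_dead_of_rstep F N θ χ p hrstep hθ hκ hE₀ hB₀ k hk (ppSel_succ_idem_of_liveSel F N θ χ hsel p k)
    (fun a hne V => dead_of_ppSel_succ_ne_of_liveSel F N θ χ hsel p k a hne V) Rz W U hT

end LiveSel

/-! ## §3  AT K0a's RE-PIN AND AT THE WITNESSES CARRYING K0b's RESIDUALS — history-indexed `Rz`, `W`, `U` (the clauses `hres` ∕ `hsel`, admissibility and signs discharged by name) -/

end Literature.MathematicalPhysics.QuantumFieldTheory.Balaban1983to89.B16RLeafRecord13LiveGenericZSChi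

end

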